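import Summits.Ventures.CertifiedManyBodySolver.Observables.TorusPairLROCeilingTTPrime
import Literature.MathematicalPhysics.QuantumLattice.TorusLimitSectorGroundStatesChargedRows
import HarnessLib

/-!
# Koma–Tasaki's torus ceiling with the chemical potential BRACKETED: `m⋆(μ)² ≤ c` on the subdifferential
# `[μ₋(n), μ₊(n)]` (hence on any certified envelope) bounds the torus pair LRO of the sector ground states

HONEST FRAMING: a CEILING on torus pair LRO by the response order parameter (the known direction, Koma–Tasaki 1993
Thm 7.3); a ceiling never speaks to the presence of pairing; not a superconductivity verdict; no number here. Crew
hubbard-obs (D-0042), seat hubbard-obs-gs-2 (`prover-hubbard-obs-gs-2-g3-0`); reader corollary of hubbard-cq-p4's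
`TorusPairLROCeiling.eventually_torusDiagonal_le_of_sectorGroundStates`. Zero compute; no definition; no named fact;
no `sorry`.

cq's theorem asks for `m⋆(t',U,μ)² ≤ c` at every chemical potential `μ` SUPPORTING a density-`n` mean-energy
minimiser of `H^{t t'} − μN` — a set a certificate cannot enumerate. The supporting chemical potentials of density `n`
are EXACTLY the subdifferential `[μ₋(n), μ₊(n)]` of the ground-state energy density (Literature
`IsMeanEnergyMinimiser.chemPot_mem_Icc_of_density` / `IsTranslationInvariant.isMeanEnergyMinimiser_hubbardTTPrimeMu_of_mem_Icc`),
so the hypothesis may be stated on `[μ₋(n), μ₊(n)]` — and therefore discharged on any CERTIFIED envelope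
`[hlo, hhi] ⊇ [μ₋(n), μ₊(n)]` (tree: `chemPotMinusTT'_ge_of_bounds`, `chemPotPlusTT'_le_of_bounds`, the cell's
`μ`-brackets) by a cover with certified response ceilings `m⋆(μ) ≤ m(h₀; μ)` cell by cell:

* `isMeanEnergyMinimiser_meanEnergy_eq_energyDensityTT'` — a density-`n` minimiser of the `μ`-pencil has `t–t'`
  mean energy `e(t,t',U,n)`; `isMeanEnergyMinimiser_chemPot_mem_Icc` — hence its `μ` lies in `[μ₋(n), μ₊(n)]`.
* **`eventually_torusDiagonal_le_of_sectorGroundStates_of_forall_mem_Icc`** — `U ≥ 0`, `0 < n < 2`: if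
  `m⋆(t',U,μ)² ≤ c` for every `μ ∈ [μ₋(n), μ₊(n)]` then for every family of unit `(rectN n L, S^z = 0)`-sector
  ground states of `hubbardTorusTT' L 1 t' U` along `L_j → ∞` and every `ε > 0`, eventually `s_{L_j} ≤ c + ε`;
  `…_of_forall_mem_Icc_of_subset` — the same from any interval `[lo, hi] ⊇ [μ₋(n), μ₊(n)]`.

References: T. Koma, H. Tasaki, Commun. Math. Phys. 158 (1993) 191, Theorem 7.3 [KomaTasaki1993]; D. Ruelle,
*Statistical Mechanics: Rigorous Results* (1969) §3.4 [Ruelle1969].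
-/

noncomputable section

namespace Summit.Ventures.CertifiedManyBodySolver.Observables.TorusPairLROCeiling

open Matrix Finset Filter Topology Set Literature.MathematicalPhysics.QuantumLattice
open Literature.Probability.LatticeModels HubbardWave0 ThermodynamicLimit
open scoped ComplexOrder

/-! ### The supporting chemical potentials of density `n` are the subdifferential -/

section Support

variable {t t' U n μ : ℝ} {ω : InfVolFermionState 2}

/-- **A density-`n` minimiser of `H^{tt'} − μN` has `t–t'` mean energy `e(t,t',U,n)`** (`U ≥ 0`, `0 < n < 2`):
`≤` by comparison with a translation-invariant state attaining `e(n)` at density `n`, `≥` by the variational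
principle. [cite: Ruelle1969, §3.4] -/
theorem isMeanEnergyMinimiser_meanEnergy_eq_energyDensityTT' (hU : 0 ≤ U) (hn0 : 0 < n) (hn2 : n < 2)
    (hmin : ω.IsMeanEnergyMinimiser (hubbardTTPrimeMuInteraction t t' U μ) 1) (hρ : ω.density = n) :
    ω.meanEnergy (hubbardTTPrimeFermionInteraction t t' U) 1 = energyDensityTT' t t' U n := by
  refine le_antisymm ?_
    (InfVolFermionState.energyDensityTT'_le_meanEnergy_of_isTranslationInvariant t t' hU hn0 hn2 hmin.1 hρ)
  obtain ⟨ψn, Lsn, σ, -, -, hσTI, -, -, -, hσρ, -, hσe⟩ :=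
    exists_isTorusLimitOf_squareGroundStatesTT'_meanEnergy_eq (t := t) (t' := t') hU hn0.le hn2
  have h := hmin.2 σ hσTI
  rw [InfVolFermionState.meanEnergy_hubbardTTPrimeMu, InfVolFermionState.meanEnergy_hubbardTTPrimeMu, hρ, hσρ,
    hσe] at h
  linarith

/-- **The chemical potential of a density-`n` minimiser lies in the subdifferential `[μ₋(n), μ₊(n)]`.**
[cite: Ruelle1969, §3.4] -/
theorem isMeanEnergyMinimiser_chemPot_mem_Icc (hU : 0 ≤ U) (hn0 : 0 < n) (hn2 : n < 2)
    (hmin : ω.IsMeanEnergyMinimiser (hubbardTTPrimeMuInteraction t t' U μ) 1) (hρ : ω.density = n) :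
    μ ∈ Set.Icc (chemPotMinusTT' t t' U n) (chemPotPlusTT' t t' U n) :=
  hmin.chemPot_mem_Icc_of_density t t' hU hn0 hn2 hρ
    (isMeanEnergyMinimiser_meanEnergy_eq_energyDensityTT' hU hn0 hn2 hmin hρ)

end Support

/-! ### The torus ceiling with the bracket -/

section Sector

variable {ψ : ∀ L, Fock (Orb (FermionTorus 2 L))} {Ls : ℕ → ℕ} [∀ j, NeZero (Ls j)] {t' U n : ℝ}

/-- **Koma–Tasaki's torus ceiling from the subdifferential.** `U ≥ 0`, `0 < n < 2`. If `m⋆(t',U,μ)² ≤ c` for every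
`μ ∈ [μ₋(n), μ₊(n)]`, then for unit `(rectN n L, S^z = 0)`-sector ground states of `hubbardTorusTT' (Ls j) 1 t' U`
along `L_j → ∞`: `∀ ε > 0`, eventually `s_{L_j} ≤ c + ε` (`s_L = torusDiagonal g_d L ψ_L`).
[cite: KomaTasaki1993, Theorem 7.3] [cite: Ruelle1969, §3.4] -/
theorem eventually_torusDiagonal_le_of_sectorGroundStates_of_forall_mem_Icc (hU : 0 ≤ U) (hn0 : 0 < n)
    (hn2 : n < 2) (hLs : Tendsto Ls atTop atTop)
    (hψ : ∀ j, IsGroundStateInSector (hubbardTorusTT' (Ls j) 1 t' U) (rectN n (Ls j)) 0 (ψ (Ls j)))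
    (hunit : ∀ j, star (ψ (Ls j)) ⬝ᵥ ψ (Ls j) = 1) {c : ℝ}
    (hc : ∀ μ ∈ Set.Icc (chemPotMinusTT' 1 t' U n) (chemPotPlusTT' 1 t' U n), dWaveOrderParameterTT' t' U μ ^ 2 ≤ c)
    {ε : ℝ} (hε : 0 < ε) :
    ∀ᶠ j in atTop, torusDiagonal dWaveFormFactor (Ls j) (ψ (Ls j)) ≤ c + ε :=
  eventually_torusDiagonal_le_of_sectorGroundStates hU hn0 hn2 hLs hψ hunit
    (fun μ _ hmin hρ => hc μ (isMeanEnergyMinimiser_chemPot_mem_Icc hU hn0 hn2 hmin hρ)) hε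

/-- **… from any interval containing the subdifferential** (a certified envelope `[lo, hi] ⊇ [μ₋(n), μ₊(n)]`).
[cite: KomaTasaki1993, Theorem 7.3] -/
theorem eventually_torusDiagonal_le_of_sectorGroundStates_of_forall_mem_Icc_of_subset (hU : 0 ≤ U)
    (hn0 : 0 < n) (hn2 : n < 2) (hLs : Tendsto Ls atTop atTop)
    (hψ : ∀ j, IsGroundStateInSector (hubbardTorusTT' (Ls j) 1 t' U) (rectN n (Ls j)) 0 (ψ (Ls j)))
    (hunit : ∀ j, star (ψ (Ls j)) ⬝ᵥ ψ (Ls j) = 1) {lo hi c : ℝ} (hlo : lo ≤ chemPotMinusTT' 1 t' U n)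
    (hhi : chemPotPlusTT' 1 t' U n ≤ hi) (hc : ∀ μ ∈ Set.Icc lo hi, dWaveOrderParameterTT' t' U μ ^ 2 ≤ c)
    {ε : ℝ} (hε : 0 < ε) :
    ∀ᶠ j in atTop, torusDiagonal dWaveFormFactor (Ls j) (ψ (Ls j)) ≤ c + ε :=
  eventually_torusDiagonal_le_of_sectorGroundStates_of_forall_mem_Icc hU hn0 hn2 hLs hψ hunit
    (fun μ hμ => hc μ ⟨hlo.trans hμ.1, hμ.2.trans hhi⟩) hε

end Sector

end Summit.Ventures.CertifiedManyBodySolver.Observables.TorusPairLROCeiling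

end
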